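import Summits.BirchSwinnertonDyer.BirchSwinnertonDyer.Theorems.GenusKolyvaginAtTwoTorsionCellGenusTracePoints
import Summits.BirchSwinnertonDyer.BirchSwinnertonDyer.Theorems.GenusKolyvaginAtTwoTorsionCellGenusDepthTwistDescentGalois
import HarnessLib

/-!
# LINE 49 «full_vertex» — the Ψ-LAW: the rational support test for depth-2 classes (pen memo `psi_law.md`, §2–§3)

Crux R″ `RankOneTwoTorsionResidualAtTwo` (stmt-BirchSwinnertonDyer-27478) of route GenusKolyvaginAtTwo, LINE 49
«torsion_cell_full_vertex_bsdidea1» (pen bsd-idea-1); sequel of `…GenusTracePoints` (Galois-fixed rational `2`-torsion)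
and `…GenusDepthTwistDescentGalois` (eigenvectors are twist points).  The pen's memo «Ψ-LAW — the rational support law for
depth-2 classes at `k = 2`» (2026-09-01, r1) attaches to every halvable odd twist class `δ` the Kummer class
`c_δ = κ^{(δ)}(g_δ + t_δ)` and proves (LEMMA §2, «THEOREM-ON-PAPER», first descent only): if `u` is the `ε`-support of a
depth-2 class, i.e. `Σ_{δ∈u} R_δ ∈ 2Λ̃ + M′ + E₀[2]` with `2R_δ = g′_δ + t_δ`, then `Ψ(u) := ∏_{δ∈u} c_δ = 1`.  This file is
that lemma and its §3 corollaries as KERNEL theorems, DEF-FREE, in the algebraic form the proof actually uses: for `σ` in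
the acting group put `ψ_δ(σ) := σ • R_δ − χ_δ(σ) • R_δ` (memo §2 (i)); `Ψ(u) = 1` reads `Σ_{δ∈u} ψ_δ ≡ 0`.

* §1 (any `DistribMulAction` of a group `G` on an abelian group `A`): `two_nsmul_psi_eq_zero` — `ψ_δ(σ) ∈ A[2]`;
  `psi_add_eq_psi_of_two_nsmul_eq_zero` — `ψ_δ` does not depend on the choice of the half `R_δ` (mod `G`-fixed `A[2]`);
  `psi_mul` — `ψ_δ(στ) = ψ_δ(σ) + ψ_δ(τ)` (a homomorphism `G → A[2]`) once `G` fixes `A[2]`;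
  `exists_smul_sub_self_eq_two_nsmul_of_mem_span` — `σ • m − m ∈ 2A` for `m ∈ M′ = Σ ℤ g′` spanned by `±1`-eigenvectors;
  ★ **`sum_psi_eq_zero_of_sum_half_eq`** — THE Ψ-TEST (memo §2 (iii)): `Σ_{δ∈u} R_δ = 2 • Y + m + s` with
  `σ • m − m ∈ 2A`, `s ∈ A[2]`, `G` fixing `A[2]` and `A[4] = A[2]` FORCES `Σ_{δ∈u} ψ_δ(σ) = 0`;
  `sum_psi_eq_zero_of_sum_half_mem_span` (the `M′`-form); `not_forall_sum_insert_and_of_exists_psi_ne_zero` — memo §3: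
  `Ψ(u ∪ {δ₀}) = Ψ(u) · c_{δ₀}`, so if `c_{δ₀} ≠ 1` AT MOST ONE of `u`, `u ∪ {δ₀}` passes the test (`u = O ∖ {−p₀}`).
* §2 (any abelian group): `two_nsmul_ne_add_of_generator` — PRIMITIVITY: if `B = ℤ g₀ + B_tors` with `g₀` of infinite
  order, then `g₀ + t ∉ 2B` for every torsion `t` (memo §3 (L0 bis): `E^{(−p₀)}(ℚ) ≅ ℤ ⊕ (ℤ/2)²`).
* §3 (the objects): on `E(L) = (V.baseChange L).toAffine.Point` under the tree's Galois action
  (`WeierstrassCurve.instDistribMulActionAlgEquivPoint`) for `V/F` with RATIONAL `2`-torsion (`SplitTwoTorsion`, so `E(L)[2]`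
  is `Aut(L/F)`-fixed by `…GenusTrace.smul_eq_self_of_two_nsmul_eq_zero`): ★ **`sum_psi_eq_zero_point`** — the Ψ-test on
  `E₀(K_gen)` with the single arithmetic input `E(L)[4] = E(L)[2]` ((T4), dischargeable by `…LevelZero.
  two_nsmul_eq_zero_of_four_nsmul_eq_zero` over `L`); and for the completed-square model `W^{(1)}` with the twisting map
  `τ : W^{(c)}(F) →+ W^{(1)}(L)` (`L/F` Galois, `θ² = c`, `χ_θ` the sign character):
  ★ **`exists_psi_ne_zero_of_two_nsmul_eq_twistMap`** — if `2 • R = τ P₀` with `P₀ ∉ 2 W^{(c)}(F)` then `ψ ≢ 0`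
  (`ψ ≡ 0` makes `R` a `χ_θ`-eigenvector, hence `R = τ R′` by `…GenusDepth.exists_twistMap_eq_of_forall_smul_eq_signChar_smul`,
  and `2R′ = P₀` by injectivity of `τ`); `exists_psi_ne_zero_of_generator` — the same from `W^{(c)}(F) = ℤ g₀ + tors`,
  `P₀ = g₀ + t` (memo §3: «`c_{−p₀} ≠ (1,1)` always», hence «at most one of `O`, `O ∖ {−p₀}` passes the Ψ-test»).

* §4 (appended): `two_nsmul_psi_eq_zero_point`, `smul_psi_eq_psi_point`, ★ **`psi_mul_point`** — on `E(L)` with rational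
  `2`-torsion the side inputs of §1 are automatic: `ψ` is a HOMOMORPHISM `Aut(L/F) → E(L)[2]` (memo §2 (i)); `psi_one`.

Dictionary (memo §0–§2): `A = Λ̃ = E₀(K_gen)`, `G = Gal(K_gen/ℚ)` (or `Aut(K_gen/K)`), `g d = g′_δ`, `t d = t_δ`,
`R d = R_δ`, `χ d = χ_δ`, `M′ = Σ_δ ℤ g′_δ`; `F = ℚ` (or `K`), `L = K_gen`, `W^{(c)} = E^{(δ)}`, `τ = φ_δ` on rational points.
NOT here: the identification (ii) of `ψ_δ` with the Kummer class of `g_δ + t_δ` in `H¹(ℚ, E[2])` computed from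
`Sel₂(E^{(δ)}/ℚ)` (needs the twisting isomorphism over `L`, not only on `F`-points), the value `c_{−p₀} = (−p₀, −p₀)`
(local symbols), the SUPPORT LAW on `𝔉` (a finite Selmer computation, memo §4) and the converse of the test (second
descent, not claimed by the memo).  Everything is proved (no `sorry`, standard axioms); nothing here is a statement of the
line, and NOTHING HERE PROVES R″ or any summit — BSD is not advanced by this file alone.

## References

* [SilvermanAEC2009] J. H. Silverman, *The Arithmetic of Elliptic Curves*, 2nd ed. (2009), VIII.§2 (Kummer pairing and its
  cocycle), X.1 Prop. 1.4 (complete `2`-descent), X.2 / X.5 Cor. 5.4 / Exercise 10.16 (twists over `F(√c)`).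
* [Kramer1981] K. Kramer, *Arithmetic of elliptic curves upon quadratic extension*, Trans. AMS 264 (1981) (points of `E`
  and its twist inside `E(F(√c))`).
-/

noncomputable section

namespace Summit.BirchSwinnertonDyer.BirchSwinnertonDyer.Theorems.GenusKolyvaginAtTwo.FullVertex.PsiLaw

open BigOperators Finset

/-! ## §1 The cocycle `ψ(σ) = σ • R − χ(σ) • R` of a half of an eigenvector, and the Ψ-test -/

section Smul

variable {ι G A : Type*} [Group G] [AddCommGroup A] [DistribMulAction G A]

/-- For `u = ±1` and `2 • t = 0`: `t − u • t = 0`. [cite: SilvermanAEC2009, VIII.§2] -/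
theorem sub_units_smul_eq_zero_of_two_nsmul_eq_zero (u : ℤˣ) (t : A) (ht : (2 : ℕ) • t = 0) :
    t - ((u : ℤ)) • t = 0 := by
  rcases Int.units_eq_one_or u with rfl | rfl
  · rw [Units.val_one, one_zsmul, sub_self]
  · rw [Units.val_neg, Units.val_one, neg_one_zsmul, sub_neg_eq_add, ← two_nsmul, ht]

/-- For `u = ±1` and `2 • x = 0`: `u • x = x`. [cite: SilvermanAEC2009, VIII.§2] -/
theorem units_smul_eq_self_of_two_nsmul_eq_zero (u : ℤˣ) (x : A) (hx : (2 : ℕ) • x = 0) :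
    ((u : ℤ)) • x = x := by
  have h := sub_units_smul_eq_zero_of_two_nsmul_eq_zero u x hx
  rwa [sub_eq_zero, eq_comm] at h

/-- **`ψ` is `2`-torsion-valued** (memo §2 (i)).  If `σ • g = χ(σ) • g`, `σ • t = t`, `2 • t = 0` and `R` is a HALF of
`g + t` (`2 • R = g + t`), then `ψ(σ) := σ • R − χ(σ) • R` satisfies `2 • ψ(σ) = 0`:
`2ψ(σ) = σ(g + t) − χ(σ)(g + t) = (1 − χ(σ)) t = 0`. [cite: SilvermanAEC2009, VIII.§2] -/
theorem two_nsmul_psi_eq_zero (χ : G → ℤˣ) (g t R : A) (σ : G) (hg : σ • g = ((χ σ : ℤˣ) : ℤ) • g)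
    (ht : (2 : ℕ) • t = 0) (hσt : σ • t = t) (hR : (2 : ℕ) • R = g + t) :
    (2 : ℕ) • (σ • R - ((χ σ : ℤˣ) : ℤ) • R) = 0 := by
  rw [smul_sub, smul_comm (2 : ℕ) σ R, smul_comm (2 : ℕ) ((χ σ : ℤˣ) : ℤ) R, hR, smul_add, smul_add, hσt, hg,
    add_sub_add_left_eq_sub]
  exact sub_units_smul_eq_zero_of_two_nsmul_eq_zero (χ σ) t ht

/-- **`ψ` does not depend on the choice of the half** (memo §2 (i)): replacing `R` by `R + T` with `2 • T = 0`, `σ • T = T`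
(another half of `g + t`, or of `g + t′`) does not change `σ • R − χ(σ) • R`. [cite: SilvermanAEC2009, VIII.§2] -/
theorem psi_add_eq_psi_of_two_nsmul_eq_zero (χ : G → ℤˣ) (R T : A) (σ : G) (hT : (2 : ℕ) • T = 0) (hσT : σ • T = T) :
    σ • (R + T) - ((χ σ : ℤˣ) : ℤ) • (R + T) = σ • R - ((χ σ : ℤˣ) : ℤ) • R := by
  rw [smul_add, smul_add, hσT, units_smul_eq_self_of_two_nsmul_eq_zero (χ σ) T hT]
  abel

/-- **`ψ` is a homomorphism** (memo §2 (i)): for a character `χ`, if `σ` fixes `ψ(τ)` and `2 • ψ(σ) = 0`, then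
`ψ(στ) = ψ(σ) + ψ(τ)` (`στR = σ(ψ(τ) + χ(τ)R) = ψ(τ) + χ(τ)ψ(σ) + χ(σ)χ(τ)R` and `χ(τ)ψ(σ) = ψ(σ)`).
[cite: SilvermanAEC2009, VIII.§2] -/
theorem psi_mul (χ : G →* ℤˣ) (R : A) (σ τ : G)
    (hfix : σ • (τ • R - ((χ τ : ℤˣ) : ℤ) • R) = τ • R - ((χ τ : ℤˣ) : ℤ) • R)
    (h2 : (2 : ℕ) • (σ • R - ((χ σ : ℤˣ) : ℤ) • R) = 0) :
    (σ * τ) • R - ((χ (σ * τ) : ℤˣ) : ℤ) • R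
      = (σ • R - ((χ σ : ℤˣ) : ℤ) • R) + (τ • R - ((χ τ : ℤˣ) : ℤ) • R) := by
  have hτR : τ • R = (τ • R - ((χ τ : ℤˣ) : ℤ) • R) + ((χ τ : ℤˣ) : ℤ) • R := by abel
  have hστ : (σ * τ) • R = (τ • R - ((χ τ : ℤˣ) : ℤ) • R) + ((χ τ : ℤˣ) : ℤ) • (σ • R) := by
    rw [mul_smul, hτR, smul_add, hfix, smul_comm σ ((χ τ : ℤˣ) : ℤ) R, ← hτR]
  have hσR : ((χ τ : ℤˣ) : ℤ) • (σ • R)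
      = ((χ τ : ℤˣ) : ℤ) • (σ • R - ((χ σ : ℤˣ) : ℤ) • R) + ((χ (σ * τ) : ℤˣ) : ℤ) • R := by
    rw [map_mul, Units.val_mul, mul_comm, mul_smul, ← smul_add]
    congr 1
    abel
  rw [hστ, hσR, units_smul_eq_self_of_two_nsmul_eq_zero (χ τ) _ h2]
  abel

/-- `σ • m − m ∈ 2A` for `m` in the `ℤ`-span `M′` of `±1`-eigenvectors `g i` of `σ` (`σ • g i = ε i • g i`): on a
generator `σ g − g = (ε − 1) g ∈ {0, −2g}`. [cite: SilvermanAEC2009, Exercise 10.16] -/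
theorem exists_smul_sub_self_eq_two_nsmul_of_mem_span {κ : Type*} (g : κ → A) (ε : κ → ℤˣ) (σ : G)
    (hg : ∀ i, σ • g i = ((ε i : ℤˣ) : ℤ) • g i) {m : A} (hm : m ∈ Submodule.span ℤ (Set.range g)) :
    ∃ m' : A, σ • m - m = (2 : ℕ) • m' := by
  induction hm using Submodule.span_induction with
  | mem x hx =>
    obtain ⟨i, rfl⟩ := hx
    rcases Int.units_eq_one_or (ε i) with h | h
    · exact ⟨0, by rw [hg i, h, Units.val_one, one_zsmul, sub_self, smul_zero]⟩
    · exact ⟨-g i, by rw [hg i, h, Units.val_neg, Units.val_one, neg_one_zsmul, two_nsmul]; abel⟩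
  | zero => exact ⟨0, by rw [smul_zero, sub_self, smul_zero]⟩
  | add x y _ _ hx hy =>
    obtain ⟨x', hx'⟩ := hx
    obtain ⟨y', hy'⟩ := hy
    exact ⟨x' + y', by rw [smul_add, smul_add, ← hx', ← hy']; abel⟩
  | smul a x _ hx =>
    obtain ⟨x', hx'⟩ := hx
    exact ⟨a • x', by rw [smul_comm σ a x, ← smul_sub, hx', smul_comm a (2 : ℕ) x']⟩

/-- Bookkeeping: `σ • R − R = ψ(σ) − [χ(σ) = −1] • 2 • R`. [cite: SilvermanAEC2009, VIII.§2] -/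
theorem smul_sub_self_eq_psi_sub_ite (χ : G → ℤˣ) (R : A) (σ : G) :
    σ • R - R = (σ • R - ((χ σ : ℤˣ) : ℤ) • R) - (if ((χ σ : ℤˣ) : ℤ) = -1 then (2 : ℕ) • R else 0) := by
  rcases Int.units_eq_one_or (χ σ) with h | h
  · rw [h, Units.val_one, one_zsmul, if_neg (by norm_num), sub_zero]
  · rw [h, Units.val_neg, Units.val_one, neg_one_zsmul, if_pos rfl, two_nsmul]
    abel

/-- **THE Ψ-TEST** (memo §2 (iii), «THEOREM-ON-PAPER», here a theorem).  Let `G` act on `A` fixing `s` and the `t d`, with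
`A[4] = A[2]` (`4 • Q = 0 → 2 • Q = 0`).  Let `R d` be halves of `g d + t d` (`2 • t d = 0`) with `σ • g d = χ d σ • g d`
for `d ∈ u`, and suppose the class `Σ_{d∈u} R d` is REALISED up to `M′` and `2`-torsion:
`Σ_{d∈u} R d = 2 • Y + m + s` with `σ • m − m ∈ 2A` and `σ • s = s` (e.g. `s ∈ A[2]`).  Then `Σ_{d∈u} ψ_d(σ) = 0`.
Proof: apply `σ − 1`; the left side is `Σ ψ_d(σ) − 2 Σ_{χ_d(σ)=−1} R d`, the right side lies in `2A`; so
`Σ ψ_d(σ) = 2Q`, and `2 Σ ψ_d(σ) = 0` gives `4Q = 0`, hence `2Q = 0`. [cite: SilvermanAEC2009, VIII.§2] -/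
theorem sum_psi_eq_zero_of_sum_half_eq (hT4 : ∀ Q : A, (4 : ℕ) • Q = 0 → (2 : ℕ) • Q = 0)
    (χ : ι → G → ℤˣ) (g t R : ι → A) (u : Finset ι) (σ : G)
    (hg : ∀ d ∈ u, σ • g d = ((χ d σ : ℤˣ) : ℤ) • g d) (ht : ∀ d ∈ u, (2 : ℕ) • t d = 0)
    (hσt : ∀ d ∈ u, σ • t d = t d) (hR : ∀ d ∈ u, (2 : ℕ) • R d = g d + t d)
    {Y m s : A} (hm : ∃ m' : A, σ • m - m = (2 : ℕ) • m') (hσs : σ • s = s)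
    (hsum : ∑ d ∈ u, R d = (2 : ℕ) • Y + m + s) :
    ∑ d ∈ u, (σ • R d - ((χ d σ : ℤˣ) : ℤ) • R d) = 0 := by
  classical
  obtain ⟨m', hm'⟩ := hm
  -- apply `σ − 1` to the realisation
  have h1 : ∑ d ∈ u, (σ • R d - R d) = (2 : ℕ) • (σ • Y - Y + m') := by
    rw [Finset.sum_sub_distrib, ← Finset.smul_sum, hsum, smul_add, smul_add, hσs, smul_comm σ (2 : ℕ) Y,
      show σ • m = (2 : ℕ) • m' + m from by rw [← hm']; abel, smul_add, smul_sub]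
    abel
  -- the left side, rewritten through `ψ`
  have h2 : ∑ d ∈ u, (σ • R d - R d)
      = ∑ d ∈ u, (σ • R d - ((χ d σ : ℤˣ) : ℤ) • R d)
        - (2 : ℕ) • ∑ d ∈ u.filter (fun d => ((χ d σ : ℤˣ) : ℤ) = -1), R d := by
    rw [Finset.sum_congr rfl fun d _ => smul_sub_self_eq_psi_sub_ite (χ d) (R d) σ, Finset.sum_sub_distrib,
      Finset.sum_filter, Finset.smul_sum]
    congr 1
    exact Finset.sum_congr rfl fun d _ => by split_ifs <;> simp
  set Q : A := σ • Y - Y + m' + ∑ d ∈ u.filter (fun d => ((χ d σ : ℤˣ) : ℤ) = -1), R d with hQ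
  have key : ∑ d ∈ u, (σ • R d - ((χ d σ : ℤˣ) : ℤ) • R d) = (2 : ℕ) • Q := by
    have := h2.symm.trans h1
    rw [sub_eq_iff_eq_add] at this
    rw [this, hQ, ← smul_add]
  have h4 : (4 : ℕ) • Q = 0 := by
    rw [show (4 : ℕ) = 2 * 2 from rfl, mul_smul, ← key, Finset.smul_sum]
    exact Finset.sum_eq_zero fun d hd => two_nsmul_psi_eq_zero (χ d) (g d) (t d) (R d) σ (hg d hd) (ht d hd)
      (hσt d hd) (hR d hd)
  rw [key]
  exact hT4 Q h4

/-- **The Ψ-test, `M′`-form**: as `sum_psi_eq_zero_of_sum_half_eq` with `m ∈ M′ := Σ_i ℤ g′ i` the span of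
`±1`-eigenvectors `g′ i` of `σ` (the odd-twist generators; in the memo `g′ = g` on `O`). [cite: SilvermanAEC2009, VIII.§2] -/
theorem sum_psi_eq_zero_of_sum_half_mem_span (hT4 : ∀ Q : A, (4 : ℕ) • Q = 0 → (2 : ℕ) • Q = 0)
    (χ : ι → G → ℤˣ) (g t R : ι → A) (u : Finset ι) (σ : G)
    (hg : ∀ d ∈ u, σ • g d = ((χ d σ : ℤˣ) : ℤ) • g d) (ht : ∀ d ∈ u, (2 : ℕ) • t d = 0)
    (hσt : ∀ d ∈ u, σ • t d = t d) (hR : ∀ d ∈ u, (2 : ℕ) • R d = g d + t d)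
    {κ : Type*} (g' : κ → A) (ε : κ → ℤˣ) (hg' : ∀ i, σ • g' i = ((ε i : ℤˣ) : ℤ) • g' i)
    {Y m s : A} (hm : m ∈ Submodule.span ℤ (Set.range g')) (hσs : σ • s = s)
    (hsum : ∑ d ∈ u, R d = (2 : ℕ) • Y + m + s) :
    ∑ d ∈ u, (σ • R d - ((χ d σ : ℤˣ) : ℤ) • R d) = 0 :=
  sum_psi_eq_zero_of_sum_half_eq hT4 χ g t R u σ hg ht hσt hR
    (exists_smul_sub_self_eq_two_nsmul_of_mem_span g' ε σ hg' hm) hσs hsum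

omit [Group G] [DistribMulAction G A] in
/-- **At most one of `u`, `u ∪ {δ₀}` passes the Ψ-test** (memo §3): `Σ_{insert δ₀ u} ψ_d = ψ_{δ₀} + Σ_u ψ_d`
(`Ψ(O) = Ψ(O ∖ {−p₀}) · c_{−p₀}`), so if `ψ_{δ₀}(σ) ≠ 0` for some `σ`, the two sums cannot both vanish identically.
[cite: SilvermanAEC2009, VIII.§2] -/
theorem not_forall_sum_insert_and_of_exists_psi_ne_zero [DecidableEq ι] (ψ : ι → G → A) (u : Finset ι) {δ₀ : ι}
    (hδ₀ : δ₀ ∉ u) (h : ∃ σ, ψ δ₀ σ ≠ 0) :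
    ¬ ((∀ σ, ∑ d ∈ insert δ₀ u, ψ d σ = 0) ∧ ∀ σ, ∑ d ∈ u, ψ d σ = 0) := by
  rintro ⟨h1, h2⟩
  obtain ⟨σ, hσ⟩ := h
  apply hσ
  have := h1 σ
  rwa [Finset.sum_insert hδ₀, h2 σ, add_zero] at this

end Smul

/-! ## §2 Primitivity: `g₀ + t ∉ 2B` when `B = ℤ g₀ + B_tors` -/

section Primitive

variable {B : Type*} [AddCommGroup B]

/-- **Primitivity** (memo §3 (L0 bis)).  If every element of `B` is `a • g₀` up to torsion and `g₀` has infinite order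
(`B ≅ ℤ ⊕ finite`, e.g. `E^{(−p₀)}(ℚ) ≅ ℤ ⊕ (ℤ/2)²`), then `2 • P ≠ g₀ + t` for every torsion `t`: otherwise
`(1 − 2a) • g₀` would be torsion. [cite: SilvermanAEC2009, VIII.§2] -/
theorem two_nsmul_ne_add_of_generator (g₀ : B) (hg₀ : ¬ IsOfFinAddOrder g₀)
    (hgen : ∀ P : B, ∃ a : ℤ, P - a • g₀ ∈ AddCommGroup.torsion B) {t : B} (ht : t ∈ AddCommGroup.torsion B)
    (P : B) : (2 : ℕ) • P ≠ g₀ + t := by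
  intro hP
  obtain ⟨a, ha⟩ := hgen P
  -- `(1 - 2a) • g₀ = 2 • (P - a • g₀) - t` is torsion
  have hmem : (1 - 2 * a) • g₀ ∈ AddCommGroup.torsion B := by
    have : (1 - 2 * a) • g₀ = (2 : ℕ) • (P - a • g₀) - t := by
      rw [smul_sub, hP, sub_smul, one_smul, mul_smul, two_nsmul, two_zsmul]
      abel
    rw [this]
    exact sub_mem (AddSubgroup.nsmul_mem _ ha 2) ht
  rw [AddCommGroup.mem_torsion, isOfFinAddOrder_iff_nsmul_eq_zero] at hmem
  obtain ⟨n, hn, hng⟩ := hmem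
  apply hg₀
  rw [isOfFinAddOrder_iff_zsmul_eq_zero]
  refine ⟨(n : ℤ) * (1 - 2 * a), mul_ne_zero (by exact_mod_cast hn.ne') (by omega), ?_⟩
  rw [mul_smul, natCast_zsmul, hng]

end Primitive

/-! ## §3 On `E(L)` under `Aut(L/F)`: the Ψ-test for rational `2`-torsion, and `ψ ≢ 0` for a primitive twist point -/

section Points

open WeierstrassCurve WeierstrassCurve.QuadraticDescent
open scoped Classical

universe u

variable {F L : Type u} [Field F] [Field L] [Algebra F L]

/-- **THE Ψ-TEST ON `E(L)`** (memo §2 LEMMA).  `V/F` with rational `2`-torsion (`SplitTwoTorsion`), `L ⊇ F`, the tree's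
action of `Aut(L/F)` on `E(L)`; arithmetic input (T4): `E(L)` has no point of order `4`.  Let `σ ∈ Aut(L/F)`,
`g d, t d, R d ∈ E(L)` (`d ∈ u`) with `σ • g d = χ d σ • g d`, `2 • t d = O`, `2 • R d = g d + t d`, and let
`M′ = Σ_i ℤ g′ i` be spanned by `±1`-eigenvectors of `σ`.  If `Σ_{d∈u} R d = 2 • Y + m + s` with `m ∈ M′`, `2 • s = O`,
then `Σ_{d∈u} (σ • R d − χ d σ • R d) = O` — «`u` is an `ε`-support ⟹ `Ψ(u) = 1`».  The `2`-torsion is `σ`-fixed by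
`…GenusTrace.smul_eq_self_of_two_nsmul_eq_zero`. [cite: SilvermanAEC2009, VIII.§2] [cite: SilvermanAEC2009, Prop. X.1.4] -/
theorem sum_psi_eq_zero_point [CharZero F] [CharZero L] (V : WeierstrassCurve F) [V.IsElliptic] {e₁ e₂ e₃ : F}
    (h : V.toAffine.SplitTwoTorsion e₁ e₂ e₃)
    (hT4 : ∀ Q : (V.baseChange L).toAffine.Point, (4 : ℕ) • Q = 0 → (2 : ℕ) • Q = 0)
    {ι : Type*} (χ : ι → (L ≃ₐ[F] L) → ℤˣ) (g t R : ι → (V.baseChange L).toAffine.Point) (u : Finset ι)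
    (σ : L ≃ₐ[F] L) (hg : ∀ d ∈ u, σ • g d = ((χ d σ : ℤˣ) : ℤ) • g d) (ht : ∀ d ∈ u, (2 : ℕ) • t d = 0)
    (hR : ∀ d ∈ u, (2 : ℕ) • R d = g d + t d)
    {κ : Type*} (g' : κ → (V.baseChange L).toAffine.Point) (ε : κ → ℤˣ)
    (hg' : ∀ i, σ • g' i = ((ε i : ℤˣ) : ℤ) • g' i)
    {Y m s : (V.baseChange L).toAffine.Point} (hm : m ∈ Submodule.span ℤ (Set.range g')) (hs : (2 : ℕ) • s = 0)
    (hsum : ∑ d ∈ u, R d = (2 : ℕ) • Y + m + s) :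
    ∑ d ∈ u, (σ • R d - ((χ d σ : ℤˣ) : ℤ) • R d) = 0 :=
  sum_psi_eq_zero_of_sum_half_mem_span hT4 χ g t R u σ hg ht
    (fun d hd => GenusTrace.smul_eq_self_of_two_nsmul_eq_zero V h (t d) (ht d hd) σ) hR g' ε hg' hm
    (GenusTrace.smul_eq_self_of_two_nsmul_eq_zero V h s hs σ) hsum

variable [FiniteDimensional F L] [IsGalois F L] [NeZero (2 : F)] (W : WeierstrassCurve F) {θ : L} {c : F}
  (hθ : θ ∉ Set.range (algebraMap F L)) (hc : θ ^ 2 = algebraMap F L c)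

/-- **`ψ ≢ 0` for a half of a primitive twist point** (memo §3 (L0 bis), mechanism).  `L/F` finite Galois, `θ ∈ L ∖ F`,
`θ² = c`, `χ` a sign function of `θ` (`σ θ = χ σ • θ`), `τ : W^{(c)}(F) →+ W^{(1)}(L)` the twisting map.  If `R ∈ W^{(1)}(L)`
is a half of a twist point, `2 • R = τ P₀`, and `P₀ ∉ 2 W^{(c)}(F)`, then `σ • R ≠ χ σ • R` for some `σ ∈ Aut(L/F)`:
were `R` a `χ`-eigenvector it would be `τ R′` (`…GenusDepth.exists_twistMap_eq_of_forall_smul_eq_signChar_smul`), and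
`2 • R′ = P₀` by injectivity of `τ`.  («`c_δ = 1` would make `g_δ + t_δ` divisible by `2` in `E^{(δ)}(ℚ)`.»)
[cite: SilvermanAEC2009, Exercise 10.16] [cite: SilvermanAEC2009, VIII.§2] -/
theorem exists_psi_ne_zero_of_two_nsmul_eq_twistMap (χ : (L ≃ₐ[F] L) → ℤˣ)
    (hχ : ∀ σ : L ≃ₐ[F] L, σ θ = ((χ σ : ℤˣ) : ℤ) • θ)
    (P₀ : (W.quadraticTwist c).toAffine.Point) (hP₀ : ∀ R' : (W.quadraticTwist c).toAffine.Point, (2 : ℕ) • R' ≠ P₀)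
    (R : ((W.quadraticTwist 1).baseChange L).toAffine.Point) (hR : (2 : ℕ) • R = twistMap W hθ hc P₀) :
    ∃ σ : L ≃ₐ[F] L, σ • R - ((χ σ : ℤˣ) : ℤ) • R ≠ 0 := by
  by_contra hall
  simp only [not_exists, ne_eq, not_not] at hall
  obtain ⟨R', hR'⟩ := GenusDepth.exists_twistMap_eq_of_forall_smul_eq_signChar_smul W hθ hc χ hχ R
    fun σ => sub_eq_zero.mp (hall σ)
  refine hP₀ R' (twistMap_injective W hθ hc ?_)
  rw [map_nsmul, hR', hR]

/-- **`ψ ≢ 0` from the rank-one twist data** (memo §3 (L0 bis)): if `W^{(c)}(F) = ℤ g₀ + tors` with `g₀` of infinite order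
(the odd twist `E^{(δ)}(ℚ)`, rank one), `t` is torsion, and `R ∈ W^{(1)}(L)` is a half of `τ(g₀ + t)`, then
`σ • R ≠ χ σ • R` for some `σ` — the class `c_δ` of the memo is never trivial; with
`not_forall_sum_insert_and_of_exists_psi_ne_zero`: at most one of `O`, `O ∖ {δ}` passes the Ψ-test.
[cite: SilvermanAEC2009, Exercise 10.16] [cite: SilvermanAEC2009, VIII.§2] -/
theorem exists_psi_ne_zero_of_generator (χ : (L ≃ₐ[F] L) → ℤˣ)
    (hχ : ∀ σ : L ≃ₐ[F] L, σ θ = ((χ σ : ℤˣ) : ℤ) • θ)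
    (g₀ : (W.quadraticTwist c).toAffine.Point) (hg₀ : ¬ IsOfFinAddOrder g₀)
    (hgen : ∀ P : (W.quadraticTwist c).toAffine.Point,
      ∃ a : ℤ, P - a • g₀ ∈ AddCommGroup.torsion (W.quadraticTwist c).toAffine.Point)
    {t : (W.quadraticTwist c).toAffine.Point} (ht : t ∈ AddCommGroup.torsion (W.quadraticTwist c).toAffine.Point)
    (R : ((W.quadraticTwist 1).baseChange L).toAffine.Point) (hR : (2 : ℕ) • R = twistMap W hθ hc (g₀ + t)) :
    ∃ σ : L ≃ₐ[F] L, σ • R - ((χ σ : ℤˣ) : ℤ) • R ≠ 0 :=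
  exists_psi_ne_zero_of_two_nsmul_eq_twistMap W hθ hc χ hχ (g₀ + t)
    (fun R' => two_nsmul_ne_add_of_generator g₀ hg₀ hgen ht R') R hR

end Points

/-! ## §4 `ψ` is a homomorphism `Aut(L/F) → E(L)[2]` ON POINTS (memo §2 (i), side inputs discharged) -/

section PointsHom

open WeierstrassCurve
open scoped Classical

universe v

variable {F L : Type v} [Field F] [Field L] [Algebra F L] [CharZero F] [CharZero L]
  (V : WeierstrassCurve F) [V.IsElliptic] {e₁ e₂ e₃ : F}

/-- **`ψ(σ) ∈ E(L)[2]` on points**: `V/F` with rational `2`-torsion, `g, t, R ∈ E(L)` with `σ • g = χ(σ) • g`, `2 • t = O`,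
`2 • R = g + t`; then `2 • (σ • R − χ(σ) • R) = O` (the input «`σ` fixes `t`» of `two_nsmul_psi_eq_zero` is automatic:
`t ∈ E(L)[2] = E(F)[2]`). [cite: SilvermanAEC2009, VIII.§2] [cite: SilvermanAEC2009, Prop. X.1.4] -/
theorem two_nsmul_psi_eq_zero_point (h : V.toAffine.SplitTwoTorsion e₁ e₂ e₃) (χ : (L ≃ₐ[F] L) → ℤˣ)
    (g t R : (V.baseChange L).toAffine.Point) (σ : L ≃ₐ[F] L) (hg : σ • g = ((χ σ : ℤˣ) : ℤ) • g)
    (ht : (2 : ℕ) • t = 0) (hR : (2 : ℕ) • R = g + t) :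
    (2 : ℕ) • (σ • R - ((χ σ : ℤˣ) : ℤ) • R) = 0 :=
  two_nsmul_psi_eq_zero χ g t R σ hg ht (GenusTrace.smul_eq_self_of_two_nsmul_eq_zero V h t ht σ) hR

/-- **`ψ(τ)` is Galois-fixed on points** (it is `2`-torsion, hence `F`-rational). [cite: SilvermanAEC2009, Prop. X.1.4] -/
theorem smul_psi_eq_psi_point (h : V.toAffine.SplitTwoTorsion e₁ e₂ e₃) (χ : (L ≃ₐ[F] L) → ℤˣ)
    (g t R : (V.baseChange L).toAffine.Point) (σ τ : L ≃ₐ[F] L) (hg : τ • g = ((χ τ : ℤˣ) : ℤ) • g)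
    (ht : (2 : ℕ) • t = 0) (hR : (2 : ℕ) • R = g + t) :
    σ • (τ • R - ((χ τ : ℤˣ) : ℤ) • R) = τ • R - ((χ τ : ℤˣ) : ℤ) • R :=
  GenusTrace.smul_eq_self_of_two_nsmul_eq_zero V h _ (two_nsmul_psi_eq_zero_point V h χ g t R τ hg ht hR) σ

/-- ★ **`ψ` IS A HOMOMORPHISM on points** (memo §2 (i) «`ψ_δ` is a homomorphism `G_ℚ → E₀[2]`», with its two side inputs —
`ψ` is `2`-torsion-valued and `E(L)[2]` is Galois-fixed — DISCHARGED for `V/F` with rational `2`-torsion): for a character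
`χ : Aut(L/F) →* ℤˣ`, a `χ`-eigenvector `g`, `2 • t = O` and a half `R` of `g + t`,
`ψ(στ) = ψ(σ) + ψ(τ)` for all `σ, τ`. [cite: SilvermanAEC2009, VIII.§2] [cite: SilvermanAEC2009, Prop. X.1.4] -/
theorem psi_mul_point (h : V.toAffine.SplitTwoTorsion e₁ e₂ e₃) (χ : (L ≃ₐ[F] L) →* ℤˣ)
    (g t R : (V.baseChange L).toAffine.Point) (hg : ∀ σ : L ≃ₐ[F] L, σ • g = ((χ σ : ℤˣ) : ℤ) • g)
    (ht : (2 : ℕ) • t = 0) (hR : (2 : ℕ) • R = g + t) (σ τ : L ≃ₐ[F] L) :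
    (σ * τ) • R - ((χ (σ * τ) : ℤˣ) : ℤ) • R
      = (σ • R - ((χ σ : ℤˣ) : ℤ) • R) + (τ • R - ((χ τ : ℤˣ) : ℤ) • R) :=
  psi_mul χ R σ τ (smul_psi_eq_psi_point V h χ g t R σ τ (hg τ) ht hR)
    (two_nsmul_psi_eq_zero_point V h χ g t R σ (hg σ) ht hR)

omit [CharZero F] [CharZero L] [V.IsElliptic] in
/-- `ψ(1) = O`. [cite: SilvermanAEC2009, VIII.§2] -/
theorem psi_one (χ : (L ≃ₐ[F] L) →* ℤˣ) (R : (V.baseChange L).toAffine.Point) :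
    (1 : L ≃ₐ[F] L) • R - ((χ 1 : ℤˣ) : ℤ) • R = 0 := by
  rw [one_smul, map_one, Units.val_one, one_zsmul, sub_self]

end PointsHom

end Summit.BirchSwinnertonDyer.BirchSwinnertonDyer.Theorems.GenusKolyvaginAtTwo.FullVertex.PsiLaw

end
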